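import Literature.Analysis.FluidPDE.AxisymNoSwirlSpeedCap
import Literature.Analysis.FluidPDE.AxisymBiotSavartSupBoundEighth
import HarnessLib

/-!
# The all-time speed cap for single-signed, finite-impulse axisymmetric flows without swirl,
# with the constant `1/(2√2) = 0.35355…` (Gallay–Šverák 2015, assembled; constant sharpened)

Analysis/FluidPDE literature file, PROOF-ONLY (no definition, no named fact). The twin of
`GallaySverak2015.speedCap_three` (`AxisymNoSwirlSpeedCap.lean`, constant `3`) with the sharpened
Biot–Savart constant of `AxisymBiotSavartSupBoundEighth.lean`
(`norm_biotSavart_le_sqrt_div_eight`: `‖K₃ ∗ ω‖_∞ ≤ √(M ∫‖ω‖ / 8)`):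

* `GallaySverak2015.speedCap_sqrt_div_eight` — for every Tao-class solution (`ν = 1`) on `[0, T]`
  from an axisymmetric swirl-free datum `u₀` with `0 ≤ η₀ = ω_θ/r ≤ M`, `η₀ ∈ L¹(ℝ³)`,
  `r²η₀ ∈ L¹(ℝ³)`: `‖u(t, x)‖ ≤ √( √((∫η₀ dx)(∫r²η₀ dx)) · M / 8 )` for all `t ∈ [0, T]`, `x`;
* `GallaySverak2015.speedCap_eighth` — the same as `‖u(t,x)‖ ≤ 0.35356 · √( √((∫η₀)(∫r²η₀)) · M )`,
  the shape of the cell's cap predicate `IsNoSwirlCapConstant C` (crux `HeredityAtOne`, Negative lane)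
  with `C = 0.35356` in place of `3`.

Ingredients (all theorems of the tree): Lemma 5.1 (`∫η(t) ≤ ∫η₀`) and Lemma 6.4 (impulse
conservation) packaged as `IsTaoSolutionOn.integrable_curl_and_integral_norm_curl_le_of_datum`
(`∫‖ω(t)‖ ≤ √((∫η₀)(∫r²η₀))`), the maximum principle `‖ω(t, y)‖ ≤ M r(y)`
(`IsTaoSolutionOn.norm_curl_le_mul_cylRadius_of_datum`), the Biot–Savart representation
`u(t) = K₃ ∗ ω(t)` (`IsTaoSolutionOn.biotSavart_curl_eq`), and (2.14) with the constant `1/(2√2)`.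
In the paper's units (`dx = 2π r dr dz`, `𝓘 = ∫_Ω r²η₀ dr dz`):
`‖u(t)‖_{L^∞} ≤ (2√2)⁻¹ (2π)^{1/2} (‖η₀‖_{L¹(Ω)} 𝓘)^{1/4} M^{1/2}`.

WHAT THIS IS NOT: not a statement about blow-up or regularity of Navier–Stokes — an a-priori,
uniform-in-time sup bound for a globally regular class (swirl-free axisymmetric), used by the cell
`pub/ns-blowup` as the «speed-cap lever» on the negative lane of crux `HeredityAtOne`
(stmt-NavierStokesRegularity-19249); this file only replaces the number `3` by `0.35356`.

## Mathlib / tree search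

`lean search 'speedCap_three|speedCap_eighth|sqrt_div_eight'` (2026-08-26): `speedCap_three` (p459550)
and `norm_biotSavart_le_sqrt_div_eight` (p473341); no cap with a constant below `3` before this file.

## References

* Th. Gallay, V. Šverák, *Remarks on the Cauchy problem for the axisymmetric Navier–Stokes
  equations*, Confluentes Math. 7 (2015) 67–92 = arXiv:1510.01036: Prop. 2.6 (2.14) (p. 8),
  Lemma 5.1 (p. 16), Lemma 6.4 (p. 19). [GallaySverak2016]
-/

noncomputable section

open MeasureTheory Set Function Filter Topology
open scoped RealInnerProductSpace ENNReal NNReal ContDiff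

namespace Literature.Analysis.FluidPDE

/-- **ALL-TIME SPEED CAP WITH THE CONSTANT `1/(2√2)`** (Gallay–Šverák 2015, Prop. 2.6 (2.14) +
Lemma 5.1 + Lemma 6.4 + maximum principle; the constant of (2.14) as proved in
`AxisymBiotSavartSupBoundEighth.lean`): for every Tao-class solution (`ν = 1`) on `[0, T]` from an
axisymmetric swirl-free datum `u₀` with `0 ≤ η₀ = ω_θ/r ≤ M`, `η₀ ∈ L¹(ℝ³)`, `r²η₀ ∈ L¹(ℝ³)`:
`‖u(t, x)‖ ≤ √( √((∫η₀ dx)(∫r²η₀ dx)) · M / 8 )` for all `t ∈ [0, T]` and `x`.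
[cite: GallaySverak2016, Prop. 2.6 (2.14), Lemma 5.1, Lemma 6.4 (arXiv pp. 8, 16, 19)] -/
theorem GallaySverak2015.speedCap_sqrt_div_eight
    ⦃T : ℝ⦄ ⦃u₀ : EuclideanSpace ℝ (Fin 3) → EuclideanSpace ℝ (Fin 3)⦄
    ⦃u : ℝ → EuclideanSpace ℝ (Fin 3) → EuclideanSpace ℝ (Fin 3)⦄
    ⦃p : ℝ → EuclideanSpace ℝ (Fin 3) → ℝ⦄ ⦃M : ℝ⦄
    (hT : 0 < T) (h : IsTaoSolutionOn T 1 u₀ u p) (h0 : IsAxisymmetric u₀) (h0' : HasNoSwirl u₀)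
    (hη0 : ∀ x, 0 ≤ angVortQuot u₀ x) (hηM : ∀ x, angVortQuot u₀ x ≤ M)
    (hL1 : Integrable (angVortQuot u₀))
    (hImp : Integrable (fun x => cylRadius x ^ 2 * angVortQuot u₀ x)) :
    ∀ t ∈ Icc 0 T, ∀ x,
      ‖u t x‖ ≤ Real.sqrt (Real.sqrt ((∫ y, angVortQuot u₀ y) *
        ∫ y, cylRadius y ^ 2 * angVortQuot u₀ y) * M / 8) := by
  intro t ht x
  have hM0 : 0 ≤ M := (hη0 0).trans (hηM 0)
  have hu3 : ContDiff ℝ 3 (u t) := (h.classical.contDiff_velocity ht).of_le (by norm_cast)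
  have hu1 : ContDiff ℝ 1 (u t) := hu3.of_le (by norm_cast)
  have hax : IsAxisymmetric (u t) := h.isAxisymmetric one_pos hT h0 t ht
  have habs0 : ∀ y, |angVortQuot u₀ y| ≤ M := fun y => by
    rw [abs_of_nonneg (hη0 y)]; exact hηM y
  have hωr : ∀ y, ‖curl (u t) y‖ ≤ M * cylRadius y := fun y =>
    h.norm_curl_le_mul_cylRadius_of_datum hT one_pos h0 h0' habs0 ht y
  obtain ⟨hωint, hAω⟩ :=
    h.integrable_curl_and_integral_norm_curl_le_of_datum hT h0 h0' hη0 hL1 hImp ht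
  have hωc : Continuous (curl (u t)) := continuous_curl hu1
  have hωax : IsAxisymmetric (curl (u t)) := hax.curl (hu1.differentiable (by simp))
  have hBSt := norm_biotSavart_le_sqrt_div_eight_of_isAxisymmetric hωc hωint hωax hωr x
  rw [h.biotSavart_curl_eq ht hωint] at hBSt
  refine hBSt.trans (Real.sqrt_le_sqrt ?_)
  exact div_le_div_of_nonneg_right (mul_le_mul_of_nonneg_right hAω hM0) (by norm_num)

/-- **THE CAP WITH ITS NUMBER, `C = 0.35356`** (`1/(2√2) = 0.353553…`): under the hypotheses of
`GallaySverak2015.speedCap_sqrt_div_eight`,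
`‖u(t, x)‖ ≤ 0.35356 · √( √((∫η₀ dx)(∫r²η₀ dx)) · M )` — the statement shape of
`GallaySverak2015.speedCap_three` with `3` replaced by `0.35356`.
[cite: GallaySverak2016, Prop. 2.6 (2.14), Lemma 5.1, Lemma 6.4 (arXiv pp. 8, 16, 19)] -/
theorem GallaySverak2015.speedCap_eighth
    ⦃T : ℝ⦄ ⦃u₀ : EuclideanSpace ℝ (Fin 3) → EuclideanSpace ℝ (Fin 3)⦄
    ⦃u : ℝ → EuclideanSpace ℝ (Fin 3) → EuclideanSpace ℝ (Fin 3)⦄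
    ⦃p : ℝ → EuclideanSpace ℝ (Fin 3) → ℝ⦄ ⦃M : ℝ⦄
    (hT : 0 < T) (h : IsTaoSolutionOn T 1 u₀ u p) (h0 : IsAxisymmetric u₀) (h0' : HasNoSwirl u₀)
    (hη0 : ∀ x, 0 ≤ angVortQuot u₀ x) (hηM : ∀ x, angVortQuot u₀ x ≤ M)
    (hL1 : Integrable (angVortQuot u₀))
    (hImp : Integrable (fun x => cylRadius x ^ 2 * angVortQuot u₀ x)) :
    ∀ t ∈ Icc 0 T, ∀ x,
      ‖u t x‖ ≤ 0.35356 * Real.sqrt (Real.sqrt ((∫ y, angVortQuot u₀ y) *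
        ∫ y, cylRadius y ^ 2 * angVortQuot u₀ y) * M) := by
  intro t ht x
  have hM0 : 0 ≤ M := (hη0 0).trans (hηM 0)
  have h1 := GallaySverak2015.speedCap_sqrt_div_eight hT h h0 h0' hη0 hηM hL1 hImp t ht x
  set G : ℝ := Real.sqrt ((∫ y, angVortQuot u₀ y) * ∫ y, cylRadius y ^ 2 * angVortQuot u₀ y) * M
    with hGdef
  have hG0 : 0 ≤ G := mul_nonneg (Real.sqrt_nonneg _) hM0
  refine h1.trans ?_
  rw [show G / 8 = (1 / 8) * G by ring, Real.sqrt_mul (by norm_num)]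
  gcongr
  rw [Real.sqrt_le_left (by norm_num)]
  norm_num

end Literature.Analysis.FluidPDE

end
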